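import Mathlib
import Summits.ResolutionOfSingularities.ResolutionOfSingularities.Theorems.RadicialJungCleanModelsCleanLU3ArcCoreOrder
import HarnessLib

/-!
# Route `RadicialJung`, crux `CleanModels` (stmt-15917), stub `stub_cleanLU3DefectArcInfinite`: the core, part 2 — from the order
# estimate to a REGULAR PARAMETER one stage up (differential criterion), and the clean representative `π · f₁`

Line `Sketch` rev 20 of crux stmt-ResolutionOfSingularities-15917; lead `res-B-lead-1` g3.  OURS; nothing here proves resolution in
characteristic `p`.

`arc_infinite_core`: with the data of `arc_infinite_order` (`f = h - c^p ∈ 𝔪ⱼ^d`, `v f ≤ v π ^ (d+1)`, `d = j + α + 1 = pL + 1`,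
`v (E h) = v π ^ α` for a derivation `E` preserving `R₀`): `f = π^d f₁` with `f₁ ∈ R_{j+1}`; the transported derivation
`π^{j+1} E` satisfies `π^{j+1} E f₁ = u - d f₁ (πʲ E π)` with `u = E h / π^α` a unit, hence is a unit, so `f₁ ∈ 𝔪 ∖ ((π) + 𝔪²)`
(differential criterion ✓ `not_mem_sq_of_derivation`), `(π, f₁, t₃)` is a regular system of parameters of `R_{j+1}`, and
`(h - c^p)/π^{pL} = π · f₁` — loose clean form (1).
-/

noncomputable section

set_option linter.dupNamespace false -- mandated namespace of this single-conjunct summit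

open IsLocalRing Polynomial
open Literature.AlgebraicGeometry.Resolution

namespace Summit.ResolutionOfSingularities.ResolutionOfSingularities.Theorems.RadicialJung.CleanModels

variable {K : Type} [Field K]

/-- **Core of the arc case with arbitrary residue tower** (perfect residue fields).  See the module docstrings of this file and of
`…ArcCoreOrder`. [folklore] -/
theorem arc_infinite_core {O : ValuationSubring K} {p : ℕ} [hp : Fact p.Prime] [CharP K p]
    (R : ℕ → Subring K) [hR : ∀ i, IsLocalRing (R i)] (hreg : ∀ i, IsRegularLocalRing (R i))
    (hdim : ∀ i, ringKrullDim (R i) = 3)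
    (h0 : SubringDominates (R 0) O.toSubring) (hstep : ∀ i, IsQuadraticTransformAlong O (R i) (R (i + 1)))
    (π : K) (hπR : π ∈ R 0) (hπ0 : π ≠ 0) (hvπ : O.valuation π < 1)
    (hπ : ∀ x : K, O.valuation x < 1 → O.valuation x ≤ O.valuation π)
    (harch : ∀ x : K, x ≠ 0 → ∃ n : ℕ, O.valuation π ^ n ≤ O.valuation x)
    (a : Fin 3 → K) (haR : ∀ l, a l ∈ R 0) (ha0 : a 0 = π)
    (hm : maximalIdeal (R 0) = Ideal.span (Set.range fun l => (⟨a l, haR l⟩ : R 0)))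
    (hperf : ∀ (i : ℕ) (b : K), b ∈ R i → ∃ t : K, t ∈ R i ∧ O.valuation (b - t ^ p) < 1)
    (hperfO : ∀ b : K, b ∈ O → ∃ t : K, t ∈ O ∧ O.valuation (b - t ^ p) < 1)
    (E : Fin 3 → Derivation ℤ K K) (hE : ∀ l y, y ∈ R 0 → E l y ∈ R 0) (e : K)
    (hve : O.valuation e = 1) (hdual : ∀ l m, E l (a m) = if l = m then e else 0)
    (h : K) (hh : h ∈ R 0) (hEh : ∃ l, E l h ≠ 0)
    (happrox : ∀ N : ℕ, ∃ b : K, O.valuation (h - b ^ p) ≤ O.valuation π ^ N) :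
    ∃ (n L : ℕ) (c f₁ t₃ : K) (hf₁ : f₁ ∈ R (n + 1)) (ht₃ : t₃ ∈ R (n + 1)) (hπn : π ∈ R (n + 1)),
      maximalIdeal (R (n + 1)) = Ideal.span {(⟨π, hπn⟩ : R (n + 1)), ⟨f₁, hf₁⟩, ⟨t₃, ht₃⟩} ∧
      (h - c ^ p) / π ^ (p * L) = π * f₁ := by
  classical
  obtain ⟨l₀, α, j, L, c, hcR, hjα, hj1, hαeq, hvf, hford⟩ :=
    arc_infinite_order R h0 hstep π hπR hπ0 hvπ hπ harch a haR ha0 hm hperf hperfO E hE e hve hdual h hh hEh happrox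
  -- basics
  have hvπ1 : O.valuation π ≤ 1 := hvπ.le
  have hvπpos : 0 < O.valuation π := zero_lt_iff.mpr ((Valuation.ne_zero_iff _).mpr hπ0)
  have hdom : ∀ i, SubringDominates (R i) O.toSubring := fun i => (sequence_dominates h0 hstep i).1
  have hmemR : ∀ i (z : R i), z ∈ maximalIdeal (R i) ↔ O.valuation (z : K) < 1 := fun i =>
    (subringDominates_valuationSubring_iff (hdom i).1).mp (hdom i)
  have hmono : ∀ {i j : ℕ}, i ≤ j → R i ≤ R j := fun hij => sequence_monotone hstep hij
  set d : ℕ := j + α + 1 with hd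
  set f : K := h - c ^ p with hfdef
  have hfR : f ∈ R j := (R j).sub_mem (hmono (Nat.zero_le j) hh) ((R j).pow_mem hcR p)
  -- (S11) `f = π^d f₁`, `f₁ ∈ R (j+1)`
  set f₁ : K := f / π ^ d with hf₁def
  have hf₁R : f₁ ∈ R (j + 1) := div_pow_mem_succ_of_mem_pow R h0 hstep π hπR hπ0 hvπ hπ j d ⟨f, hfR⟩ hford
  have hπd0 : π ^ d ≠ 0 := pow_ne_zero _ hπ0
  have hff₁ : f = π ^ d * f₁ := by rw [hf₁def, mul_div_cancel₀ _ hπd0]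
  have hπj1 : π ∈ R (j + 1) := hmono (Nat.zero_le _) hπR
  -- (S12) the derivation `E₀ = E l₀`, transported; `E₀ h = π^α u`
  set E₀ := E l₀ with hE₀
  have hEj : ∀ y ∈ R j, π ^ j * E₀ y ∈ R j := pow_mul_derivation_mem R h0 hstep π hπR hπ0 hvπ hπ E₀ (hE l₀) j
  have hEj1 : ∀ y ∈ R (j + 1), π ^ (j + 1) * E₀ y ∈ R (j + 1) :=
    pow_mul_derivation_mem R h0 hstep π hπR hπ0 hvπ hπ E₀ (hE l₀) (j + 1)
  obtain ⟨u, huR, hvu, hEhu⟩ := exists_eq_pow_mul_unit R h0 hstep π hπR hπ0 hvπ hπ α 0 (E₀ h) (hE l₀ h hh) hαeq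
  have huR1 : u ∈ R (j + 1) := hmono (by omega) huR
  have huunit : IsUnit (⟨u, huR1⟩ : R (j + 1)) := isUnit_of_valuation_eq_one R h0 hstep (j + 1) u huR1 hvu
  have hEf : E₀ f = π ^ α * u := by
    rw [hfdef, map_sub, Derivation.leibniz_pow, hEhu]
    simp [nsmul_eq_mul]
  -- the key identity `π^(j+1) E₀ f₁ = u - d f₁ (π^j E₀ π)`
  have hkey : π ^ (j + 1) * E₀ f₁ = u - (d : K) * f₁ * (π ^ j * E₀ π) := by
    have h1 : E₀ f = π ^ d * E₀ f₁ + f₁ * ((d : K) * π ^ (d - 1) * E₀ π) := by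
      conv_lhs => rw [hff₁]
      rw [Derivation.leibniz, Derivation.leibniz_pow]
      simp only [smul_eq_mul, nsmul_eq_mul]
      ring
    have h2 : π ^ d * (π ^ (j + 1) * E₀ f₁) = π ^ d * (u - (d : K) * f₁ * (π ^ j * E₀ π)) := by
      have hd1 : d - 1 = j + α := by omega
      have epow : π ^ d = π ^ (j + 1) * π ^ α := by rw [hd, ← pow_add]; ring_nf
      have epow' : π ^ (d - 1) * π ^ (j + 1) = π ^ d * π ^ j := by rw [hd1, hd, ← pow_add, ← pow_add]; ring_nf
      calc π ^ d * (π ^ (j + 1) * E₀ f₁) = π ^ (j + 1) * (π ^ d * E₀ f₁) := by ring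
        _ = π ^ (j + 1) * (E₀ f - f₁ * ((d : K) * π ^ (d - 1) * E₀ π)) := by rw [h1]; ring
        _ = π ^ (j + 1) * (π ^ α * u) - (d : K) * f₁ * E₀ π * (π ^ (d - 1) * π ^ (j + 1)) := by rw [hEf]; ring
        _ = π ^ d * (u - (d : K) * f₁ * (π ^ j * E₀ π)) := by rw [epow', epow]; ring
    exact mul_left_cancel₀ hπd0 h2
  -- (S13) `f₁ ∈ 𝔪 ∖ 𝔪²`, and `f₁ ∉ (π) + 𝔪²`
  haveI : IsRegularLocalRing (R (j + 1)) := hreg (j + 1)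
  have hvf₁ : O.valuation f₁ < 1 := by
    have hd2 : j + α + 2 = d + 1 := by omega
    rw [hd2] at hvf
    rw [hf₁def, map_div₀, map_pow, div_lt_one₀ (pow_pos hvπpos d)]
    exact lt_of_le_of_lt hvf (valuation_pow_lt_pow O π hπ0 hvπ (Nat.lt_succ_self d))
  have hf₁m : (⟨f₁, hf₁R⟩ : R (j + 1)) ∈ maximalIdeal (R (j + 1)) := (hmemR _ _).mpr hvf₁
  have hEπR : π ^ j * E₀ π ∈ R (j + 1) := hmono (Nat.le_succ j) (hEj π (hmono (Nat.zero_le j) hπR))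
  have hEf₁mem : π ^ (j + 1) * E₀ f₁ ∈ R (j + 1) := hEj1 f₁ hf₁R
  have hEf₁unit : IsUnit (⟨π ^ (j + 1) * E₀ f₁, hEf₁mem⟩ : R (j + 1)) := by
    have e1 : (⟨π ^ (j + 1) * E₀ f₁, hEf₁mem⟩ : R (j + 1)) =
        ⟨u, huR1⟩ - (d : R (j + 1)) * ⟨f₁, hf₁R⟩ * ⟨π ^ j * E₀ π, hEπR⟩ := Subtype.ext (by
      push_cast; exact hkey)
    rw [e1]
    exact isUnit_sub_of_mem_maximalIdeal _ _ huunit (Ideal.mul_mem_right _ _ (Ideal.mul_mem_left _ _ hf₁m))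
  have hf₁2 : (⟨f₁, hf₁R⟩ : R (j + 1)) ∉ maximalIdeal (R (j + 1)) ^ 2 :=
    not_mem_sq_of_derivation E₀ (π ^ (j + 1)) hEj1 ⟨f₁, hf₁R⟩ ⟨hEf₁mem, hEf₁unit⟩
  have hπm1 : (⟨π, hπj1⟩ : R (j + 1)) ∈ maximalIdeal (R (j + 1)) := (hmemR _ _).mpr hvπ
  have hπ2 : (⟨π, hπj1⟩ : R (j + 1)) ∉ maximalIdeal (R (j + 1)) ^ 2 := by
    intro h2
    have hle := valuation_le_pow_of_mem_pow (hdom (j + 1)) π hπ 2 _ h2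
    change O.valuation π ≤ O.valuation π ^ 2 at hle
    rw [pow_two] at hle
    have : O.valuation π * 1 ≤ O.valuation π * O.valuation π := by rwa [mul_one]
    exact absurd (le_of_mul_le_mul_left this hvπpos) (not_le.mpr hvπ)
  have hnot : ∀ (a' : R (j + 1)), ∀ m₂ ∈ maximalIdeal (R (j + 1)) ^ 2, (⟨f₁, hf₁R⟩ : R (j + 1)) ≠ a' * ⟨π, hπj1⟩ + m₂ := by
    intro a' m₂ hm₂ heq
    apply (mem_maximalIdeal _ |>.mp _) hEf₁unit
    -- `π^(j+1) E₀ f₁ = a' · π^(j+1) E₀ π + π · π^(j+1) E₀ a' + π^(j+1) E₀ m₂ ∈ 𝔪`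
    have hD1 := derivation_apply_mem_pow E₀ (π ^ (j + 1)) hEj1 1 m₂ (by simpa using hm₂)
    rw [pow_one] at hD1
    have e1 : (⟨π ^ (j + 1) * E₀ f₁, hEf₁mem⟩ : R (j + 1)) =
        a' * (⟨π, hπj1⟩ * ⟨π ^ j * E₀ π, hEπR⟩) + ⟨π, hπj1⟩ * ⟨π ^ (j + 1) * E₀ (a' : K), hEj1 _ a'.2⟩ +
          ⟨π ^ (j + 1) * E₀ (m₂ : K), hEj1 _ m₂.2⟩ := by
      apply Subtype.ext
      have hf₁eq : f₁ = (a' : K) * π + (m₂ : K) := by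
        have := congrArg (fun z : R (j + 1) => (z : K)) heq; simpa using this
      simp only [Subring.coe_add, Subring.coe_mul]
      rw [hf₁eq, map_add, Derivation.leibniz, smul_eq_mul, smul_eq_mul, mul_add, pow_succ]
      ring
    rw [e1]
    refine Ideal.add_mem _ (Ideal.add_mem _ (Ideal.mul_mem_left _ _ (Ideal.mul_mem_right _ _ hπm1)) (Ideal.mul_mem_right _ _ hπm1)) hD1
  obtain ⟨t₃, ht₃⟩ := exists_span_eq_of_not_mem (hdim (j + 1)) ⟨π, hπj1⟩ ⟨f₁, hf₁R⟩ hπm1 hπ2 hf₁m hnot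
  -- (S14) conclusion
  refine ⟨j, L, c, f₁, t₃, hf₁R, t₃.2, hπj1, ht₃, ?_⟩
  change f / π ^ (p * L) = π * f₁
  rw [hff₁, hd, hjα, pow_succ, mul_assoc, mul_comm (π ^ (p * L)) (π * f₁), mul_div_assoc, div_self (pow_ne_zero _ hπ0), mul_one]

end Summit.ResolutionOfSingularities.ResolutionOfSingularities.Theorems.RadicialJung.CleanModels

end
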